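import Summits.ValiantsHypothesis.ValiantsHypothesis.Theorems.KPlusLogSqLawTropicalBSplitDefs
import Summits.ValiantsHypothesis.ValiantsHypothesis.Theorems.LacunarySymmetroidMatrixDescartesCensusTropicalKLawStatic
import Summits.ValiantsHypothesis.ValiantsHypothesis.Theorems.KPlusLogSqLawTropicalBSplitGlue

/-!
# Route `KPlusLogSqLaw`, crux `TropicalB` (stmt-ValiantsHypothesis-19771) — COLUMN FAN-OUT, part 2: the ENTRIES of the fan-out design
# (case analysis of a present entry; values on start / exit / continue / idle arcs)

HONEST FRAMING.  Helper file (seat val-sym-trop-p1 g14, cell `pub-symmetroid`, 2026-08-28) toward the registered stubs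
`stub_tropThin` / `stub_tropFat` of `Cruxes/TropicalB/Lines/birth.lean` (crux `…Theses.KPlusLogSqLaw.TropicalB`, item
`stmt-ValiantsHypothesis-19771`; `--supports … --as helper`).  Bookkeeping for the degree-3 normal form (`…TropicalBColumnFanout`, part 3).
The fan-out design is given by its defining FORMULAS as hypotheses (`hE`, `hV`; no definitions are introduced): on the index type
`Fin m × Fin (m+1)` with classes `Fin (K+1)` (class `Fin.last K` = the new zero-exponent class), column `(j,0)` has the single present
row `(j,1)`; column `(j,t)`, `t ≠ 0`, has the EXIT row `(t−1, 0)` carrying every class `Fin.castSucc l` present at the original entry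
`(t−1, j)` with the original valuation, the CONTINUE row `(j,t+1)` and the IDLE row `(j,t)` (class `last`, valuation `0`).  Lemmas:
`cases_of_E` (a present entry is one of the four kinds), `E_start`, `E_exit`, `E_cont`, `E_idle`, `V_last`, `V_exit` (the values).
Nothing here bears on `TropicalB` in its window, `WeakLifting`, the doors, `MatrixDescartes` (stmt-ValiantsHypothesis-18050) or VP ≠ VNP.
[folklore] (gadget bookkeeping).
-/

set_option linter.dupNamespace false
set_option autoImplicit false

namespace Summit.ValiantsHypothesis.ValiantsHypothesis.Theorems.KPlusLogSqLaw

open Summit.ValiantsHypothesis.ValiantsHypothesis.Theorems.MatrixDescartes.Negative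
open Summit.ValiantsHypothesis.ValiantsHypothesis.Theorems.LacunarySymmetroidMatrixDescartes
open scoped BigOperators
open Finset

namespace ColumnFanout

variable {m K : ℕ}

/-! ## 3. The fan-out design: case analysis of a present entry -/

/-- the four kinds of present entries of the fan-out design (signs `E` given by their defining formula). [folklore] -/
theorem cases_of_E (ε : Fin m → Fin m → Fin K → ℤ) (E : Fin m × Fin (m + 1) → Fin m × Fin (m + 1) → Fin (K + 1) → ℤ)
    (hE : ∀ r c l, E r c l =
      (if (c.2 : ℕ) = 0 then (if r.1 = c.1 ∧ (r.2 : ℕ) = 1 ∧ l = Fin.last K then 1 else 0)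
       else if (r.2 : ℕ) = 0 ∧ (r.1 : ℕ) + 1 = (c.2 : ℕ) then (if h : (l : ℕ) < K then ε r.1 c.1 ⟨l, h⟩ else 0)
       else if r.1 = c.1 ∧ (r.2 : ℕ) = (c.2 : ℕ) + 1 ∧ l = Fin.last K then 1
       else if r = c ∧ l = Fin.last K then 1 else 0))
    (r c : Fin m × Fin (m + 1)) (l : Fin (K + 1)) (h : E r c l ≠ 0) :
    ((c.2 : ℕ) = 0 ∧ r.1 = c.1 ∧ (r.2 : ℕ) = 1 ∧ l = Fin.last K) ∨
    ((c.2 : ℕ) ≠ 0 ∧ (r.2 : ℕ) = 0 ∧ (r.1 : ℕ) + 1 = (c.2 : ℕ) ∧ ∃ hl : (l : ℕ) < K, ε r.1 c.1 ⟨l, hl⟩ ≠ 0) ∨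
    ((c.2 : ℕ) ≠ 0 ∧ r.1 = c.1 ∧ (r.2 : ℕ) = (c.2 : ℕ) + 1 ∧ l = Fin.last K) ∨
    ((c.2 : ℕ) ≠ 0 ∧ r = c ∧ l = Fin.last K) := by
  rw [hE] at h
  by_cases h0 : (c.2 : ℕ) = 0
  · rw [if_pos h0] at h
    by_cases h1 : r.1 = c.1 ∧ (r.2 : ℕ) = 1 ∧ l = Fin.last K
    · exact Or.inl ⟨h0, h1⟩
    · rw [if_neg h1] at h; exact absurd rfl h
  · rw [if_neg h0] at h
    by_cases h1 : (r.2 : ℕ) = 0 ∧ (r.1 : ℕ) + 1 = (c.2 : ℕ)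
    · rw [if_pos h1] at h
      by_cases hl : (l : ℕ) < K
      · rw [dif_pos hl] at h
        exact Or.inr (Or.inl ⟨h0, h1.1, h1.2, hl, h⟩)
      · rw [dif_neg hl] at h; exact absurd rfl h
    · rw [if_neg h1] at h
      by_cases h2 : r.1 = c.1 ∧ (r.2 : ℕ) = (c.2 : ℕ) + 1 ∧ l = Fin.last K
      · exact Or.inr (Or.inr (Or.inl ⟨h0, h2⟩))
      · rw [if_neg h2] at h
        by_cases h3 : r = c ∧ l = Fin.last K
        · exact Or.inr (Or.inr (Or.inr ⟨h0, h3⟩))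
        · rw [if_neg h3] at h; exact absurd rfl h

/-- value of the fan-out signs on the START arc `(j,0) → (j,1)`. [folklore] -/
theorem E_start (ε : Fin m → Fin m → Fin K → ℤ) (E : Fin m × Fin (m + 1) → Fin m × Fin (m + 1) → Fin (K + 1) → ℤ)
    (hE : ∀ r c l, E r c l =
      (if (c.2 : ℕ) = 0 then (if r.1 = c.1 ∧ (r.2 : ℕ) = 1 ∧ l = Fin.last K then 1 else 0)
       else if (r.2 : ℕ) = 0 ∧ (r.1 : ℕ) + 1 = (c.2 : ℕ) then (if h : (l : ℕ) < K then ε r.1 c.1 ⟨l, h⟩ else 0)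
       else if r.1 = c.1 ∧ (r.2 : ℕ) = (c.2 : ℕ) + 1 ∧ l = Fin.last K then 1
       else if r = c ∧ l = Fin.last K then 1 else 0))
    (j : Fin m) (t t' : Fin (m + 1)) (ht : (t : ℕ) = 0) (ht' : (t' : ℕ) = 1) : E (j, t') (j, t) (Fin.last K) = 1 := by
  rw [hE]; dsimp only; rw [if_pos ht, if_pos ⟨rfl, ht', rfl⟩]

/-- value on an EXIT arc `(j, s+1) → (s, 0)` with class `castSucc l`. [folklore] -/
theorem E_exit (ε : Fin m → Fin m → Fin K → ℤ) (E : Fin m × Fin (m + 1) → Fin m × Fin (m + 1) → Fin (K + 1) → ℤ)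
    (hE : ∀ r c l, E r c l =
      (if (c.2 : ℕ) = 0 then (if r.1 = c.1 ∧ (r.2 : ℕ) = 1 ∧ l = Fin.last K then 1 else 0)
       else if (r.2 : ℕ) = 0 ∧ (r.1 : ℕ) + 1 = (c.2 : ℕ) then (if h : (l : ℕ) < K then ε r.1 c.1 ⟨l, h⟩ else 0)
       else if r.1 = c.1 ∧ (r.2 : ℕ) = (c.2 : ℕ) + 1 ∧ l = Fin.last K then 1
       else if r = c ∧ l = Fin.last K then 1 else 0))
    (j s : Fin m) (t z : Fin (m + 1)) (ht : (t : ℕ) = (s : ℕ) + 1) (hz : (z : ℕ) = 0) (l : Fin K) :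
    E (s, z) (j, t) (Fin.castSucc l) = ε s j l := by
  rw [hE]; dsimp only
  have h1 : ¬ ((t : ℕ) = 0) := by omega
  have h2 : (z : ℕ) = 0 ∧ (s : ℕ) + 1 = (t : ℕ) := ⟨hz, ht.symm⟩
  have hl : ((Fin.castSucc l : Fin (K + 1)) : ℕ) < K := by simp
  rw [if_neg h1, if_pos h2, dif_pos hl]
  rfl

/-- value on a CONTINUE arc `(j,t) → (j,t+1)`, `t ≠ 0`. [folklore] -/
theorem E_cont (ε : Fin m → Fin m → Fin K → ℤ) (E : Fin m × Fin (m + 1) → Fin m × Fin (m + 1) → Fin (K + 1) → ℤ)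
    (hE : ∀ r c l, E r c l =
      (if (c.2 : ℕ) = 0 then (if r.1 = c.1 ∧ (r.2 : ℕ) = 1 ∧ l = Fin.last K then 1 else 0)
       else if (r.2 : ℕ) = 0 ∧ (r.1 : ℕ) + 1 = (c.2 : ℕ) then (if h : (l : ℕ) < K then ε r.1 c.1 ⟨l, h⟩ else 0)
       else if r.1 = c.1 ∧ (r.2 : ℕ) = (c.2 : ℕ) + 1 ∧ l = Fin.last K then 1
       else if r = c ∧ l = Fin.last K then 1 else 0))
    (j : Fin m) (t t' : Fin (m + 1)) (ht : (t : ℕ) ≠ 0) (ht' : (t' : ℕ) = (t : ℕ) + 1) : E (j, t') (j, t) (Fin.last K) = 1 := by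
  rw [hE]; dsimp only
  have h2 : ¬ ((t' : ℕ) = 0 ∧ (j : ℕ) + 1 = (t : ℕ)) := by intro hh; omega
  rw [if_neg ht, if_neg h2, if_pos ⟨rfl, ht', rfl⟩]

/-- value on an IDLE loop `(j,t) → (j,t)`, `t ≠ 0`. [folklore] -/
theorem E_idle (ε : Fin m → Fin m → Fin K → ℤ) (E : Fin m × Fin (m + 1) → Fin m × Fin (m + 1) → Fin (K + 1) → ℤ)
    (hE : ∀ r c l, E r c l =
      (if (c.2 : ℕ) = 0 then (if r.1 = c.1 ∧ (r.2 : ℕ) = 1 ∧ l = Fin.last K then 1 else 0)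
       else if (r.2 : ℕ) = 0 ∧ (r.1 : ℕ) + 1 = (c.2 : ℕ) then (if h : (l : ℕ) < K then ε r.1 c.1 ⟨l, h⟩ else 0)
       else if r.1 = c.1 ∧ (r.2 : ℕ) = (c.2 : ℕ) + 1 ∧ l = Fin.last K then 1
       else if r = c ∧ l = Fin.last K then 1 else 0))
    (j : Fin m) (t : Fin (m + 1)) (ht : (t : ℕ) ≠ 0) : E (j, t) (j, t) (Fin.last K) = 1 := by
  rw [hE]; dsimp only
  have h2 : ¬ ((t : ℕ) = 0 ∧ (j : ℕ) + 1 = (t : ℕ)) := by intro hh; omega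
  have h3 : ¬ (j = j ∧ (t : ℕ) = (t : ℕ) + 1 ∧ Fin.last K = Fin.last K) := by intro hh; omega
  rw [if_neg ht, if_neg h2, if_neg h3, if_pos ⟨rfl, rfl⟩]

/-- the fan-out valuation vanishes on the zero-exponent class. [folklore] -/
theorem V_last (v : Fin m → Fin m → Fin K → ℤ) (V : Fin m × Fin (m + 1) → Fin m × Fin (m + 1) → Fin (K + 1) → ℤ)
    (hV : ∀ r c l, V r c l =
      (if h : (c.2 : ℕ) ≠ 0 ∧ (r.2 : ℕ) = 0 ∧ (r.1 : ℕ) + 1 = (c.2 : ℕ) ∧ (l : ℕ) < K then v r.1 c.1 ⟨l, h.2.2.2⟩ else 0))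
    (r c : Fin m × Fin (m + 1)) : V r c (Fin.last K) = 0 := by
  rw [hV, dif_neg]
  intro hh
  have := hh.2.2.2
  simp at this

/-- value of the fan-out valuation on an EXIT arc. [folklore] -/
theorem V_exit (v : Fin m → Fin m → Fin K → ℤ) (V : Fin m × Fin (m + 1) → Fin m × Fin (m + 1) → Fin (K + 1) → ℤ)
    (hV : ∀ r c l, V r c l =
      (if h : (c.2 : ℕ) ≠ 0 ∧ (r.2 : ℕ) = 0 ∧ (r.1 : ℕ) + 1 = (c.2 : ℕ) ∧ (l : ℕ) < K then v r.1 c.1 ⟨l, h.2.2.2⟩ else 0))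
    (j s : Fin m) (t z : Fin (m + 1)) (ht : (t : ℕ) = (s : ℕ) + 1) (hz : (z : ℕ) = 0) (l : Fin K) :
    V (s, z) (j, t) (Fin.castSucc l) = v s j l := by
  rw [hV]; dsimp only
  have hl : ((Fin.castSucc l : Fin (K + 1)) : ℕ) < K := by simp
  rw [dif_pos ⟨by omega, hz, ht.symm, hl⟩]
  rfl

end ColumnFanout

end Summit.ValiantsHypothesis.ValiantsHypothesis.Theorems.KPlusLogSqLaw
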